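import Mathlib
import Summits.Ventures.PercRepro2.TypedPendantA3
import Summits.Ventures.PercRepro2.TypedSpectator
import Summits.Ventures.PercRepro2.TypedTwoEdgeOStates
import Summits.Ventures.PercRepro2.TypedTwoEdgeOTwoSlot

/-!
# The pendant `a₃` at a root: the class-`2` base is a two-copy covariance count (blind cell
PercRepro2, mine-2 g54, 2026-08-29; `conjectures/MINE-2.md` M2-115)

For the kernel `K₃` of the covariance form (HCOV) (`HCovCubic.lean`, state form `KB` of
`OneTypedEdge.lean`), a typed edge `f = {a₃, a₂}` (resp. `{a₃, a₁}`) whose end `a₃` is a leaf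
carrying exactly the mark `a₃` — the pendant `a₃` of `TypedPendantA3.lean` attached at a ROOT —
has the typed bases `(N₀, N₀ + C, C, 0)`: the class-`3` base vanishes (`a₃` sits in a root cluster
in every copy, `KB_pendant_a3_at_root_three`), the class-`1` base is `N₀ + N₂` by the quadratic
identity, and the class-`2` base is the `Q`-weighted spectator count of the two-copy covariance
of `1_{o ∈ C(a₁)}` (resp. `1_{o ∈ C(a₂)}`) with the side sign `σ_b` (resp. `−σ_b`):

  **`typedCount_pendant_a3_at_a2`**:
  `N_{τ[f:=2]} = typedCount F z (τ[f:=0]) (1_Q(x) · Cov_{y,w}(1_{o∈C(a₁)}, σ_b))`,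

the typed form of the weighted row «`a₃` at `a₂`: `2(1−t)P[t·SS + (1−t)Z_H + Z_L]`» of
`conjectures/MINE-2-RULES.md` (Thm 22).  Mechanism: in a copy with `f` open the mark `a₃` lies in
`C(a₂)`, so `1_PD = 0` there and `1_Q σ₃ = −1_Q` (`pdB_of_H3`, `qB_mul_sigB_of_coinc_a2`); the three
class-`2` placements then sum POINTWISE — with no realisation relation — to the covariance kernel
plus a RELABELING kernel `(g₁ − g₁∘(23)) + (g₂ − g₂∘(13)) + (g₃ − g₃∘(123))`
(`KB_pendant_a3_at_a2_two`), whose typed count vanishes by the copy swaps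
(`typedCount_relabel_three`).  The mirror at `a₁` (`typedCount_pendant_a3_at_a1`) has
`1_{o∈C(a₂)}` and the side sign of `b` seen from `a₂`.  The other classes and the sign of the
row (the covariance kernel is the same-side plus the cross two-copy kernel of the pair `(o, b)`,
so `N₂ ≥ 0` under the typed same-side and cross statements, and row 2′TRI at a pendant `a₃` at a
root reduces to the `a₃`-inactive base plus those two-copy statements) are in
`TypedPendantA3AtRootRow.lean`.  Own work; standard axioms.
-/

namespace Summit.Ventures.PercRepro2

namespace CovForm

namespace TypedRed

open OneTyped

/-! ## States: a copy with `a₃` in a root cluster -/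

section States

/-- With `a₃ ∈ C(a₂)`, `1_PD = 0`. -/
lemma pdB_of_H3 (s : St) (h : s.H3 = true) : pdB s = 0 := by
  obtain ⟨q, lo, ho, lb, hb, l3, h3⟩ := s
  simp only [St.H3] at h
  subst h
  cases q <;> simp [pdB, St.q', St.L3, St.H3]

/-- With `a₃ ∈ C(a₁)`, `1_PD = 0`. -/
lemma pdB_of_L3 (s : St) (h : s.L3 = true) : pdB s = 0 := by
  obtain ⟨q, lo, ho, lb, hb, l3, h3⟩ := s
  simp only [St.L3] at h
  subst h
  cases q <;> simp [pdB, St.q', St.L3, St.H3]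

/-- With `a₃ ∈ C(a₂)` and `a₃ ∈ C(a₁) ↔ ¬Q`: `1_Q σ₃ = −1_Q`. -/
lemma qB_mul_sigB_of_coinc_a2 (s : St) (h : s.L3 = s.q' ∧ s.H3 = true) :
    qB s * sigB s.L3 s.H3 = -qB s := by
  obtain ⟨q, lo, ho, lb, hb, l3, h3⟩ := s
  simp only [St.L3, St.H3, St.q'] at h
  obtain ⟨h1, h2⟩ := h
  subst h2
  cases q <;> cases l3 <;> simp_all [qB, sigB, St.q', St.L3, St.H3]

/-- With `a₃ ∈ C(a₁)` and `a₃ ∈ C(a₂) ↔ ¬Q`: `1_Q σ₃ = 1_Q`. -/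
lemma qB_mul_sigB_of_coinc_a1 (s : St) (h : s.L3 = true ∧ s.H3 = s.q') :
    qB s * sigB s.L3 s.H3 = qB s := by
  obtain ⟨q, lo, ho, lb, hb, l3, h3⟩ := s
  simp only [St.L3, St.H3, St.q'] at h
  obtain ⟨h1, h2⟩ := h
  subst h1
  cases q <;> cases h3 <;> simp_all [qB, sigB, St.q', St.L3, St.H3]

/-- **Class `3` at a root**: with `a₃` in a root cluster in the first two copies, the kernel
vanishes (every term carries `1_PD` of the first or the second copy). -/
theorem KB_pendant_a3_at_root_three (x y w : St) (hx : pdB x = 0) (hy : pdB y = 0) :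
    KB x y w = 0 := by
  simp only [KB, hx, hy]
  ring

/-- **Class `2` at `a₂` on states**: for copies `x, y, w` with `a₃ ∈ C(a₂)` (`w` with
`a₃ ∈ C(a₁) ↔ ¬Q`), the three placements of the closed copy sum to the covariance kernel
`1_Q(x) 1_Q(y) 1_Q(w) · (1_{o∈C(a₁)}(w) − 1_{o∈C(a₁)}(y)) · (σ_b(w) − σ_b(y))` plus the relabeling
kernel `(g₁ − g₁∘(23)) + (g₂ − g₂∘(13)) + (g₃ − g₃∘(123))` with
`g₁ = 1_Q³ · 1_{o∈C(a₁)}(w) σ_b(w)`, `g₂ = 1_Q³ · 1_{o∈C(a₁)}(x) σ_b(y)`,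
`g₃ = 1_Q³ · 1_{o∈C(a₂)}(x) σ_b(y)`. -/
theorem KB_pendant_a3_at_a2_two (x y w : St) (hx : x.H3 = true) (hy : y.H3 = true)
    (hw : w.L3 = w.q' ∧ w.H3 = true) :
    KB (kill3 x) y w + KB x (kill3 y) w + KB x y (kill3 w) =
      qB x * qB y * qB w *
          (((if w.Lo = true then 1 else 0) - (if y.Lo = true then 1 else 0)) *
            (sigB w.Lb w.Hb - sigB y.Lb y.Hb)) +
        ((qB x * qB y * qB w * ((if w.Lo = true then 1 else 0) * sigB w.Lb w.Hb) -
            qB x * qB w * qB y * ((if y.Lo = true then 1 else 0) * sigB y.Lb y.Hb)) +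
          (qB x * qB y * qB w * ((if x.Lo = true then 1 else 0) * sigB y.Lb y.Hb) -
            qB w * qB y * qB x * ((if w.Lo = true then 1 else 0) * sigB y.Lb y.Hb)) +
          (qB x * qB y * qB w * ((if x.Ho = true then 1 else 0) * sigB y.Lb y.Hb) -
            qB y * qB w * qB x * ((if y.Ho = true then 1 else 0) * sigB w.Lb w.Hb))) := by
  have h3w := qB_mul_sigB_of_coinc_a2 w hw
  simp only [KB, pdB_kill3, qB_kill3, kill3_Lo, kill3_Ho, kill3_Lb, kill3_Hb, kill3_L3, kill3_H3,
    sigB_ff, pdB_of_H3 x hx, pdB_of_H3 y hy, pdB_of_H3 w hw.2]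
  simp only [sigB, uB] at h3w ⊢
  set qx := qB x with hqx
  set qy := qB y with hqy
  set qw := qB w with hqw
  set lox : ℤ := (if x.Lo = true then 1 else 0) with hlox
  set hox : ℤ := (if x.Ho = true then 1 else 0) with hhox
  set loy : ℤ := (if y.Lo = true then 1 else 0) with hloy
  set hoy : ℤ := (if y.Ho = true then 1 else 0) with hhoy
  set low : ℤ := (if w.Lo = true then 1 else 0) with hlow
  set how : ℤ := (if w.Ho = true then 1 else 0) with hhow
  set lby : ℤ := (if y.Lb = true then 1 else 0) with hlby
  set hby : ℤ := (if y.Hb = true then 1 else 0) with hhby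
  set lbw : ℤ := (if w.Lb = true then 1 else 0) with hlbw
  set hbw : ℤ := (if w.Hb = true then 1 else 0) with hhbw
  linear_combination
    (qx * qy * how * hbw + (-1) * qx * qy * how * lbw + qx * qy * low * hbw
      + (-1) * qx * qy * low * lbw + (-1) * qx * qy * hby * how + (-1) * qx * qy * hby * low
      + qx * qy * lby * how + qx * qy * lby * low + (-1) * qx * qy * hoy * hbw
      + qx * qy * hoy * lbw + (-1) * qx * qy * loy * hbw + qx * qy * loy * lbw
      + qx * hox * qy * hby + (-1) * qx * hox * qy * lby + qx * lox * qy * hby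
      + (-1) * qx * lox * qy * lby) * h3w

/-- **Class `2` at `a₁` on states** (the mirror): the covariance kernel
`1_Q³ · (1_{o∈C(a₂)}(w) − 1_{o∈C(a₂)}(y)) · (σ_b(y) − σ_b(w))` plus the mirrored relabeling
kernel. -/
theorem KB_pendant_a3_at_a1_two (x y w : St) (hx : x.L3 = true) (hy : y.L3 = true)
    (hw : w.L3 = true ∧ w.H3 = w.q') :
    KB (kill3 x) y w + KB x (kill3 y) w + KB x y (kill3 w) =
      qB x * qB y * qB w *
          (((if w.Ho = true then 1 else 0) - (if y.Ho = true then 1 else 0)) *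
            (sigB y.Lb y.Hb - sigB w.Lb w.Hb)) +
        ((qB x * qB w * qB y * ((if y.Ho = true then 1 else 0) * sigB y.Lb y.Hb) -
            qB x * qB y * qB w * ((if w.Ho = true then 1 else 0) * sigB w.Lb w.Hb)) +
          (qB w * qB y * qB x * ((if w.Ho = true then 1 else 0) * sigB y.Lb y.Hb) -
            qB x * qB y * qB w * ((if x.Ho = true then 1 else 0) * sigB y.Lb y.Hb)) +
          (qB y * qB w * qB x * ((if y.Lo = true then 1 else 0) * sigB w.Lb w.Hb) -
            qB x * qB y * qB w * ((if x.Lo = true then 1 else 0) * sigB y.Lb y.Hb))) := by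
  have h3w := qB_mul_sigB_of_coinc_a1 w hw
  simp only [KB, pdB_kill3, qB_kill3, kill3_Lo, kill3_Ho, kill3_Lb, kill3_Hb, kill3_L3, kill3_H3,
    sigB_ff, pdB_of_L3 x hx, pdB_of_L3 y hy, pdB_of_L3 w hw.1]
  simp only [sigB, uB] at h3w ⊢
  set qx := qB x with hqx
  set qy := qB y with hqy
  set qw := qB w with hqw
  set lox : ℤ := (if x.Lo = true then 1 else 0) with hlox
  set hox : ℤ := (if x.Ho = true then 1 else 0) with hhox
  set loy : ℤ := (if y.Lo = true then 1 else 0) with hloy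
  set hoy : ℤ := (if y.Ho = true then 1 else 0) with hhoy
  set low : ℤ := (if w.Lo = true then 1 else 0) with hlow
  set how : ℤ := (if w.Ho = true then 1 else 0) with hhow
  set lby : ℤ := (if y.Lb = true then 1 else 0) with hlby
  set hby : ℤ := (if y.Hb = true then 1 else 0) with hhby
  set lbw : ℤ := (if w.Lb = true then 1 else 0) with hlbw
  set hbw : ℤ := (if w.Hb = true then 1 else 0) with hhbw
  linear_combination
    (qx * qy * how * hbw + (-1) * qx * qy * how * lbw + qx * qy * low * hbw
      + (-1) * qx * qy * low * lbw + (-1) * qx * qy * hby * how + (-1) * qx * qy * hby * low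
      + qx * qy * lby * how + qx * qy * lby * low + (-1) * qx * qy * hoy * hbw
      + qx * qy * hoy * lbw + (-1) * qx * qy * loy * hbw + qx * qy * loy * lbw
      + qx * hox * qy * hby + (-1) * qx * hox * qy * lby + qx * lox * qy * hby
      + (-1) * qx * lox * qy * lby) * h3w

end States

/-! ## The typed count of a relabeling kernel vanishes -/

section Relabel

variable {E : Type*} [Fintype E] [DecidableEq E] {R : Type*} [Field R]

/-- A kernel of the form `(A − A∘(23)) + (B − B∘(13)) + (C − C∘(123))` has typed count `0`. -/
theorem typedCount_relabel_three (F : Finset E) (z : Config E) (τ : E → ℕ)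
    (A B C : Config E → Config E → Config E → R) :
    typedCount F z τ (fun x y w =>
      (A x y w - A x w y) + (B x y w - B w y x) + (C x y w - C y w x)) = 0 := by
  simp only [sub_eq_add_neg]
  rw [typedCount_add, typedCount_add, typedCount_add, typedCount_add, typedCount_add,
    TypedA3.typedCount_neg', TypedA3.typedCount_neg', TypedA3.typedCount_neg',
    typedCount_swap23' F z τ A, typedCount_swap13' F z τ B]
  have hC : typedCount F z τ (fun x y w => C y w x) = typedCount F z τ C := by
    have e1 := TypedA3.typedCount_swap12 F z τ (fun x y w => C x w y)
    have e2 := typedCount_swap23' F z τ C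
    exact e1.trans e2
  rw [hC]
  ring

end Relabel

/-! ## The theorems -/

section Main

open Classical

variable {V : Type*} {E : Type*} [Fintype E] [DecidableEq E] {R : Type*} [Field R]
variable (ends : E → Sym2 V) (o a₁ a₂ a₃ b : V)

omit [Fintype E] [DecidableEq E] in
/-- `1_{o ∈ C(a₁)}` through the state. -/
lemma iL_o_eq_st (ω : Config E) :
    iL ends a₁ o ω = (((if (st ends o a₁ a₂ a₃ b ω).Lo = true then 1 else 0 : ℤ)) : R) := by
  rw [iL_eq_dec]
  rfl

omit [Fintype E] [DecidableEq E] in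
/-- `1_{o ∈ C(a₂)}` through the state. -/
lemma iH_o_eq_st (ω : Config E) :
    iH ends a₂ o ω = (((if (st ends o a₁ a₂ a₃ b ω).Ho = true then 1 else 0 : ℤ)) : R) := by
  rw [iH_eq_dec]
  rfl

omit [Fintype E] [DecidableEq E] in
/-- `σ_b` through the state. -/
lemma sigma_b_eq_st (ω : Config E) :
    sigma ends a₁ a₂ b ω =
      ((sigB (st ends o a₁ a₂ a₃ b ω).Lb (st ends o a₁ a₂ a₃ b ω).Hb : ℤ) : R) := by
  unfold sigma sigB
  rw [iL_eq_dec, iH_eq_dec]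
  push_cast
  rfl

/-- **The pendant `a₃` at `a₂`, class `2`**: for a typed edge `f = {a₃, a₂}` whose end `a₃` is a
leaf carrying exactly the mark `a₃` (distinct from `o, a₁, a₂, b`), the class-`2` base is the
`Q`-weighted spectator count, on the instance with `f` of class `0` (`a₃` isolated), of the
two-copy covariance of `1_{o ∈ C(a₁)}` with the side sign `σ_b`. -/
theorem typedCount_pendant_a3_at_a2 {f : E} (hf : ends f = s(a₃, a₂))
    (hleaf : ∀ e, a₃ ∈ ends e → e = f) (h32 : a₃ ≠ a₂) (h3o : a₃ ≠ o) (h31 : a₃ ≠ a₁)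
    (h3b : a₃ ≠ b) (F : Finset E) (hfF : f ∈ F) (z : Config E) (τ : E → ℕ) :
    typedCount F z (Function.update τ f 2)
        (K3 ends o a₁ a₂ a₃ b : Config E → Config E → Config E → R) =
      typedCount F z (Function.update τ f 0) (fun x y w =>
        iQ ends a₁ a₂ x * TypedA3.covKer ends a₁ a₂ (iL ends a₁ o) (sigma ends a₁ a₂ b) y w) := by
  set S := st ends o a₁ a₂ a₃ b with hS
  have hst : ∀ x : Config E, S (Function.update x f false) =
      kill3 (S (Function.update x f true)) := fun x =>
    st_update_pendant_a3 ends o a₁ a₂ a₃ b hf hleaf h32 h3o h31 h32 h3b x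
  have hH3 : ∀ x : Config E, (S (Function.update x f true)).H3 = true := fun x =>
    decide_eq_true (conn_symm (conn_of_openAdj ⟨f, Function.update_self f true x, hf⟩))
  have hL3 : ∀ x : Config E, (S (Function.update x f true)).L3 =
      (S (Function.update x f true)).q' := fun x => by
    have h := conn_leaf_open hf (Function.update_self f true x) (v := a₁)
    exact decide_eq_decide.mpr ⟨fun h1 => h.1 (conn_symm h1), fun h1 => conn_symm (h.2 h1)⟩
  rw [typedCount_split_two F f hfF, typedCount_split_zero F f hfF]
  set A : Config E → Config E → Config E → R := fun x y w =>
    ((qB (S (Function.update x f true)) * qB (S (Function.update y f true)) *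
      qB (S (Function.update w f true)) *
      ((if (S (Function.update w f true)).Lo = true then 1 else 0) *
        sigB (S (Function.update w f true)).Lb (S (Function.update w f true)).Hb) : ℤ) : R)
    with hA
  set B : Config E → Config E → Config E → R := fun x y w =>
    ((qB (S (Function.update x f true)) * qB (S (Function.update y f true)) *
      qB (S (Function.update w f true)) *
      ((if (S (Function.update x f true)).Lo = true then 1 else 0) *
        sigB (S (Function.update y f true)).Lb (S (Function.update y f true)).Hb) : ℤ) : R)
    with hB
  set C : Config E → Config E → Config E → R := fun x y w =>
    ((qB (S (Function.update x f true)) * qB (S (Function.update y f true)) *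
      qB (S (Function.update w f true)) *
      ((if (S (Function.update x f true)).Ho = true then 1 else 0) *
        sigB (S (Function.update y f true)).Lb (S (Function.update y f true)).Hb) : ℤ) : R)
    with hC
  have key : ∀ x y w : Config E,
      (K3 ends o a₁ a₂ a₃ b (Function.update x f false) (Function.update y f true)
          (Function.update w f true) : R) +
        K3 ends o a₁ a₂ a₃ b (Function.update x f true) (Function.update y f false)
          (Function.update w f true) +
        K3 ends o a₁ a₂ a₃ b (Function.update x f true) (Function.update y f true)
          (Function.update w f false) =
      iQ ends a₁ a₂ (Function.update x f false) *
          TypedA3.covKer ends a₁ a₂ (iL ends a₁ o) (sigma ends a₁ a₂ b) (Function.update y f false)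
            (Function.update w f false) +
        ((A x y w - A x w y) + (B x y w - B w y x) + (C x y w - C y w x)) := by
    intro x y w
    have h := congrArg (Int.cast : ℤ → R) (KB_pendant_a3_at_a2_two _ _ _ (hH3 x) (hH3 y)
      ⟨hL3 w, hH3 w⟩)
    simp only [K3_eq_KB, ← hS, hst, hA, hB, hC]
    unfold TypedA3.covKer
    rw [iQ_eq_st ends o a₁ a₂ a₃ b, iQ_eq_st ends o a₁ a₂ a₃ b, iQ_eq_st ends o a₁ a₂ a₃ b,
      iL_o_eq_st ends o a₁ a₂ a₃ b, iL_o_eq_st ends o a₁ a₂ a₃ b,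
      sigma_b_eq_st ends o a₁ a₂ a₃ b, sigma_b_eq_st ends o a₁ a₂ a₃ b, ← hS, hst, hst, hst,
      qB_kill3, qB_kill3, qB_kill3, kill3_Lo, kill3_Lo, kill3_Lb, kill3_Hb, kill3_Lb, kill3_Hb]
    push_cast at h ⊢
    linear_combination h
  rw [← typedCount_add, ← typedCount_add, typedCount_congr_K _ _ _ key, typedCount_add,
    typedCount_relabel_three, add_zero]

omit [Fintype E] [DecidableEq E] in
/-- `−σ_b = σ_b` with the roots exchanged, through the state. -/
lemma sigma_b_mirror_eq_st (ω : Config E) :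
    sigma ends a₂ a₁ b ω =
      -((sigB (st ends o a₁ a₂ a₃ b ω).Lb (st ends o a₁ a₂ a₃ b ω).Hb : ℤ) : R) := by
  have h : sigma (R := R) ends a₂ a₁ b ω = -sigma (R := R) ends a₁ a₂ b ω := by
    unfold sigma iL iH
    ring
  rw [h, sigma_b_eq_st ends o a₁ a₂ a₃ b ω]

/-- **The pendant `a₃` at `a₁`, class `2`** (the mirror): the class-`2` base is the `Q`-weighted
spectator count of the two-copy covariance of `1_{o ∈ C(a₂)}` with the side sign of `b` seen
from `a₂` (`σ_b` with the roots exchanged, `= −σ_b`). -/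
theorem typedCount_pendant_a3_at_a1 {f : E} (hf : ends f = s(a₃, a₁))
    (hleaf : ∀ e, a₃ ∈ ends e → e = f) (h31 : a₃ ≠ a₁) (h3o : a₃ ≠ o) (h32 : a₃ ≠ a₂)
    (h3b : a₃ ≠ b) (F : Finset E) (hfF : f ∈ F) (z : Config E) (τ : E → ℕ) :
    typedCount F z (Function.update τ f 2)
        (K3 ends o a₁ a₂ a₃ b : Config E → Config E → Config E → R) =
      typedCount F z (Function.update τ f 0) (fun x y w =>
        iQ ends a₁ a₂ x * TypedA3.covKer ends a₁ a₂ (iH ends a₂ o) (sigma ends a₂ a₁ b) y w) := by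
  set S := st ends o a₁ a₂ a₃ b with hS
  have hst : ∀ x : Config E, S (Function.update x f false) =
      kill3 (S (Function.update x f true)) := fun x =>
    st_update_pendant_a3 ends o a₁ a₂ a₃ b hf hleaf h31 h3o h31 h32 h3b x
  have hL3 : ∀ x : Config E, (S (Function.update x f true)).L3 = true := fun x =>
    decide_eq_true (conn_symm (conn_of_openAdj ⟨f, Function.update_self f true x, hf⟩))
  have hH3 : ∀ x : Config E, (S (Function.update x f true)).H3 =
      (S (Function.update x f true)).q' := fun x => by
    have h := conn_leaf_open hf (Function.update_self f true x) (v := a₂)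
    exact decide_eq_decide.mpr ⟨fun h1 => conn_symm (h.1 (conn_symm h1)), fun h1 => conn_symm (h.2 (conn_symm h1))⟩
  rw [typedCount_split_two F f hfF, typedCount_split_zero F f hfF]
  set A : Config E → Config E → Config E → R := fun x y w =>
    ((qB (S (Function.update x f true)) * qB (S (Function.update w f true)) *
      qB (S (Function.update y f true)) *
      ((if (S (Function.update y f true)).Ho = true then 1 else 0) *
        sigB (S (Function.update y f true)).Lb (S (Function.update y f true)).Hb) : ℤ) : R)
    with hA
  set B : Config E → Config E → Config E → R := fun x y w =>
    ((qB (S (Function.update w f true)) * qB (S (Function.update y f true)) *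
      qB (S (Function.update x f true)) *
      ((if (S (Function.update w f true)).Ho = true then 1 else 0) *
        sigB (S (Function.update y f true)).Lb (S (Function.update y f true)).Hb) : ℤ) : R)
    with hB
  set C : Config E → Config E → Config E → R := fun x y w =>
    -((qB (S (Function.update x f true)) * qB (S (Function.update y f true)) *
      qB (S (Function.update w f true)) *
      ((if (S (Function.update x f true)).Lo = true then 1 else 0) *
        sigB (S (Function.update y f true)).Lb (S (Function.update y f true)).Hb) : ℤ) : R)
    with hC
  have key : ∀ x y w : Config E,
      (K3 ends o a₁ a₂ a₃ b (Function.update x f false) (Function.update y f true)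
          (Function.update w f true) : R) +
        K3 ends o a₁ a₂ a₃ b (Function.update x f true) (Function.update y f false)
          (Function.update w f true) +
        K3 ends o a₁ a₂ a₃ b (Function.update x f true) (Function.update y f true)
          (Function.update w f false) =
      iQ ends a₁ a₂ (Function.update x f false) *
          TypedA3.covKer ends a₁ a₂ (iH ends a₂ o) (sigma ends a₂ a₁ b) (Function.update y f false)
            (Function.update w f false) +
        ((A x y w - A x w y) + (B x y w - B w y x) + (C x y w - C y w x)) := by
    intro x y w
    have h := congrArg (Int.cast : ℤ → R) (KB_pendant_a3_at_a1_two _ _ _ (hL3 x) (hL3 y)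
      ⟨hL3 w, hH3 w⟩)
    simp only [K3_eq_KB, ← hS, hst, hA, hB, hC]
    unfold TypedA3.covKer
    rw [iQ_eq_st ends o a₁ a₂ a₃ b, iQ_eq_st ends o a₁ a₂ a₃ b, iQ_eq_st ends o a₁ a₂ a₃ b,
      iH_o_eq_st ends o a₁ a₂ a₃ b, iH_o_eq_st ends o a₁ a₂ a₃ b,
      sigma_b_mirror_eq_st ends o a₁ a₂ a₃ b, sigma_b_mirror_eq_st ends o a₁ a₂ a₃ b, ← hS, hst,
      hst, hst, qB_kill3, qB_kill3, qB_kill3, kill3_Ho, kill3_Ho, kill3_Lb, kill3_Hb, kill3_Lb,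
      kill3_Hb]
    push_cast at h ⊢
    linear_combination h
  rw [← typedCount_add, ← typedCount_add, typedCount_congr_K _ _ _ key, typedCount_add,
    typedCount_relabel_three, add_zero]

end Main

end TypedRed

end CovForm

end Summit.Ventures.PercRepro2
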